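import Summits.NavierStokesRegularity.FunctionalMining.NoGo.SeparableCalculus
import Summits.NavierStokesRegularity.FunctionalMining.NoGo.PairIntegrals
import HarnessLib

/-!
# The log-door packet: a shear packet in a linear strain field (exact second variation)

Search for candidate a priori estimates; no regularity claim. NS FUNCTIONAL MINING — NO-GO BRANCH
(cell `pub-nsfunc`, prove seat gen 3), Euclidean core of the no-go N6 (`PalinstrophySupRateFails`:
the unlogged row `d𝒫/dt ≤ C‖ω‖_∞𝒫` fails for every `C`; paper-level proof by the no-go seat,
`pub-nsfunc-nogo/LOGDOOR.md`; this Lean route replaces the trigonometric-polynomial packet by a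
compactly supported separable one and the checkerboard by an exactly linear strain core).

Objects on `ℝ³ = EuclideanSpace ℝ (Fin 3)` for three smooth profiles `φ = (a, g, η)` vanishing off
`[-2, 2]` and a rate `n : ℝ`:
* the PACKET `packet φ = (a(x) g'(y) η(z), −a'(x) g(y) η(z), 0) = curl(0, 0, −a g η)`-type planar
  field (divergence free, `packet_trace`);
* (companion files) the STRAIN `strain n η = n η(z) (x, −y, 0)` (`NoGo/LogDoorStrain.lean`, the core
  of the bounded-vorticity background of `NoGo/LogDoorBackground.lean`) and the second variation of
  the bi-Laplacian production `∫⟪Dv(v), Δ²v⟫` at the strain along the packet,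
  `qint φ n = ⟪DW(W), Δ²E⟫ + ⟪DE(W), Δ²W⟫ + ⟪DW(E), Δ²W⟫` (`NoGo/LogDoorSecondVariation.lean`).

MAIN IDENTITY (`integral_qint`, in `NoGo/LogDoorSecondVariation.lean`): with `Sq f l = ∫ (f⁽ˡ⁾)²,`
`∫ qint n φ = n · (∫η³) · (Sq a 3 · Sq g 0 + Sq a 2 · Sq g 1 − Sq a 1 · Sq g 2 − Sq a 0 · Sq g 3)`,
and (`integral_norm_sq_laplacian_packet`)
`∫ ‖ΔW‖² = (∫η²)(Sq a 0 Sq g 3 + 3 Sq a 1 Sq g 2 + 3 Sq a 2 Sq g 1 + Sq a 3 Sq g 0)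
          + 2(∫η'²)(Sq a 0 Sq g 2 + 2 Sq a 1 Sq g 1 + Sq a 2 Sq g 0) + (∫η''²)(Sq a 0 Sq g 1 + Sq a 1 Sq g 0)`.
Method: pointwise expansion into separable monomials (tables `tableQ`, 38 rows, and `tableP`, 12 rows,
generated by a polynomial CAS and checked here by `ring`), Fubini (`integral_sep3`), and the pair-integral
reductions of `NoGo/PairIntegrals.lean`. With `g = g_K = φ₂ cos(K·)/K²` one has `Sq g_K 3 → ∞` while
`Sq g_K l`, `l ≤ 2`, stay bounded, so `−∫ qint → +∞` at the rate of `∫‖ΔW‖²` times `n·(∫η³/∫η²)`: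
the ratio production/(‖ω‖_∞ · palinstrophy) is driven by the strain rate `n`, not by the vorticity.
Folklore calculus; nothing is asserted about Navier–Stokes.
-/

open MeasureTheory Set Function
open scoped ContDiff Laplacian InnerProductSpace RealInnerProductSpace

namespace Summit.NavierStokesRegularity.FunctionalMining

namespace Sep3

/-- `2 ≤ ∞` in `WithTop ℕ∞`. [folklore] -/
private theorem two_le_infty'' : (2 : WithTop ℕ∞) ≤ ∞ := by
  change ((2 : ℕ∞) : WithTop ℕ∞) ≤ ((⊤ : ℕ∞) : WithTop ℕ∞)
  exact_mod_cast (le_top : (2 : ℕ∞) ≤ ⊤)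

/-- `∞ ≠ 0` in `WithTop ℕ∞`. [folklore] -/
private theorem infty_ne_zero'' : (∞ : WithTop ℕ∞) ≠ 0 := by simp

/-! ## The packet -/

section Packet

variable (φ : Fin 3 → ℝ → ℝ)

/-- Scalar components of the packet `(a g' η, −a' g η, 0)`. [folklore] -/
noncomputable def UW : Fin 3 → E3 → ℝ := ![sep φ 0 1 0, -sep φ 1 0 0, 0]

/-- The packet field `W = (a(x) g'(y) η(z), −a'(x) g(y) η(z), 0)` on `ℝ³`. [folklore] -/
noncomputable def packet : E3 → E3 := vec3 (UW φ)

/-- Component `0` of the packet. [folklore] -/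
@[simp] theorem UW_zero : UW φ 0 = sep φ 0 1 0 := rfl
/-- Component `1` of the packet. [folklore] -/
@[simp] theorem UW_one : UW φ 1 = -sep φ 1 0 0 := rfl
/-- Component `2` of the packet. [folklore] -/
@[simp] theorem UW_two : UW φ 2 = fun _ => 0 := rfl

/-- Component `0` of the packet, pointwise. [folklore] -/
theorem UW_zero_apply (y : E3) : UW φ 0 y = sep φ 0 1 0 y := rfl
/-- Component `1` of the packet, pointwise. [folklore] -/
theorem UW_one_apply (y : E3) : UW φ 1 y = -sep φ 1 0 0 y := rfl
/-- Component `2` of the packet, pointwise. [folklore] -/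
theorem UW_two_apply (y : E3) : UW φ 2 y = 0 := rfl

variable {φ}

/-- The packet components are smooth. [folklore] -/
theorem contDiff_UW (hφ : ∀ a, ContDiff ℝ ∞ (φ a)) (i : Fin 3) : ContDiff ℝ ∞ (UW φ i) := by
  obtain rfl | rfl | rfl : i = 0 ∨ i = 1 ∨ i = 2 := by fin_cases i <;> simp
  · exact contDiff_sep hφ 0 1 0
  · exact (contDiff_sep hφ 1 0 0).neg
  · exact contDiff_const

/-- The packet components are differentiable. [folklore] -/
theorem differentiable_UW (hφ : ∀ a, ContDiff ℝ ∞ (φ a)) (i : Fin 3) :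
    Differentiable ℝ (UW φ i) :=
  (contDiff_UW hφ i).differentiable infty_ne_zero''

/-- The packet is smooth. [folklore] -/
theorem contDiff_packet (hφ : ∀ a, ContDiff ℝ ∞ (φ a)) : ContDiff ℝ ∞ (packet φ) :=
  contDiff_vec3 (contDiff_UW hφ)

/-- Components of the packet. [folklore] -/
theorem packet_apply (y : E3) (i : Fin 3) : packet φ y i = UW φ i y := rfl

/-- Directional derivatives of the packet, componentwise. [folklore] -/
theorem fderiv_packet_apply (hφ : ∀ a, ContDiff ℝ ∞ (φ a)) (y v : E3) (i : Fin 3) :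
    fderiv ℝ (packet φ) y v i = fderiv ℝ (UW φ i) y v :=
  fderiv_vec3_apply (differentiable_UW hφ) y v i

/-- `D W₀ (y) v = v₀ a'g'η + v₁ a g''η + v₂ a g'η'`. [folklore] -/
theorem fderiv_UW_zero (hφ : ∀ a, ContDiff ℝ ∞ (φ a)) (y v : E3) :
    fderiv ℝ (UW φ 0) y v = v 0 * sep φ 1 1 0 y + v 1 * sep φ 0 2 0 y + v 2 * sep φ 0 1 1 y := by
  rw [UW_zero, fderiv_sep_apply hφ]

/-- `D W₁ (y) v = −(v₀ a''gη + v₁ a'g'η + v₂ a'gη')`. [folklore] -/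
theorem fderiv_UW_one (hφ : ∀ a, ContDiff ℝ ∞ (φ a)) (y v : E3) :
    fderiv ℝ (UW φ 1) y v = -(v 0 * sep φ 2 0 0 y + v 1 * sep φ 1 1 0 y + v 2 * sep φ 1 0 1 y) := by
  have h : HasFDerivAt (UW φ 1) (-sepD φ 1 0 0 y) y := (hasFDerivAt_sep hφ 1 0 0 y).neg
  rw [h.fderiv, neg_apply, sepD_apply]

/-- `D W₂ = 0`. [folklore] -/
theorem fderiv_UW_two (y v : E3) : fderiv ℝ (UW φ 2) y v = 0 := by
  rw [UW_two, (hasFDerivAt_const (0 : ℝ) y).fderiv]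
  simp

/-- `ΔW₀ = a''g'η + a g'''η + a g'η''` (as a function). [folklore] -/
theorem laplacian_UW_zero (hφ : ∀ a, ContDiff ℝ ∞ (φ a)) :
    Δ (UW φ 0) = fun y => sep φ 2 1 0 y + sep φ 0 3 0 y + sep φ 0 1 2 y := by
  funext y; rw [UW_zero, laplacian_sep hφ]

/-- `ΔW₁ = −(a'''gη + a'g''η + a'gη'')` (as a function). [folklore] -/
theorem laplacian_UW_one (hφ : ∀ a, ContDiff ℝ ∞ (φ a)) :
    Δ (UW φ 1) = fun y => -(sep φ 3 0 0 y + sep φ 1 2 0 y + sep φ 1 0 2 y) := by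
  funext y
  rw [UW_one, InnerProductSpace.laplacian_neg, Pi.neg_apply, laplacian_sep hφ]

/-- `ΔW₂ = 0`. [folklore] -/
theorem laplacian_UW_two : Δ (UW φ 2) = fun _ => 0 := by
  rw [UW_two, InnerProductSpace.laplacian_const]; rfl

/-- The Laplacian of a sum of three separable monomials. [folklore] -/
theorem laplacian_sep_add3 (hφ : ∀ a, ContDiff ℝ ∞ (φ a)) (i₁ j₁ k₁ i₂ j₂ k₂ i₃ j₃ k₃ : ℕ) (y : E3) :
    Δ (fun z => sep φ i₁ j₁ k₁ z + sep φ i₂ j₂ k₂ z + sep φ i₃ j₃ k₃ z) y =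
      (sep φ (i₁ + 2) j₁ k₁ y + sep φ i₁ (j₁ + 2) k₁ y + sep φ i₁ j₁ (k₁ + 2) y) +
      (sep φ (i₂ + 2) j₂ k₂ y + sep φ i₂ (j₂ + 2) k₂ y + sep φ i₂ j₂ (k₂ + 2) y) +
      (sep φ (i₃ + 2) j₃ k₃ y + sep φ i₃ (j₃ + 2) k₃ y + sep φ i₃ j₃ (k₃ + 2) y) := by
  have h2 : ∀ i j k, ContDiffAt ℝ 2 (sep φ i j k) y := fun i j k =>
    ((contDiff_sep hφ i j k).of_le two_le_infty'').contDiffAt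
  have e : (fun z => sep φ i₁ j₁ k₁ z + sep φ i₂ j₂ k₂ z + sep φ i₃ j₃ k₃ z) =
      (sep φ i₁ j₁ k₁ + sep φ i₂ j₂ k₂) + sep φ i₃ j₃ k₃ := by
    funext z; simp
  rw [e, ContDiffAt.laplacian_add (f₁ := sep φ i₁ j₁ k₁ + sep φ i₂ j₂ k₂) (f₂ := sep φ i₃ j₃ k₃)
      ((h2 _ _ _).add (h2 _ _ _)) (h2 _ _ _),
    ContDiffAt.laplacian_add (f₁ := sep φ i₁ j₁ k₁) (f₂ := sep φ i₂ j₂ k₂) (h2 _ _ _) (h2 _ _ _),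
    laplacian_sep hφ, laplacian_sep hφ, laplacian_sep hφ]

/-- `Δ²W₀` in separable monomials. [folklore] -/
theorem laplacian2_UW_zero (hφ : ∀ a, ContDiff ℝ ∞ (φ a)) (y : E3) :
    Δ (Δ (UW φ 0)) y =
      (sep φ 4 1 0 y + sep φ 2 3 0 y + sep φ 2 1 2 y) +
      (sep φ 2 3 0 y + sep φ 0 5 0 y + sep φ 0 3 2 y) +
      (sep φ 2 1 2 y + sep φ 0 3 2 y + sep φ 0 1 4 y) := by
  rw [laplacian_UW_zero hφ, laplacian_sep_add3 hφ]

/-- `Δ²W₁` in separable monomials. [folklore] -/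
theorem laplacian2_UW_one (hφ : ∀ a, ContDiff ℝ ∞ (φ a)) (y : E3) :
    Δ (Δ (UW φ 1)) y =
      -((sep φ 5 0 0 y + sep φ 3 2 0 y + sep φ 3 0 2 y) +
        (sep φ 3 2 0 y + sep φ 1 4 0 y + sep φ 1 2 2 y) +
        (sep φ 3 0 2 y + sep φ 1 2 2 y + sep φ 1 0 4 y)) := by
  rw [laplacian_UW_one hφ]
  have e : (fun y => -(sep φ 3 0 0 y + sep φ 1 2 0 y + sep φ 1 0 2 y)) =
      -(fun y => sep φ 3 0 0 y + sep φ 1 2 0 y + sep φ 1 0 2 y) := rfl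
  rw [e, InnerProductSpace.laplacian_neg, Pi.neg_apply, laplacian_sep_add3 hφ]

/-- `Δ²W₂ = 0`. [folklore] -/
theorem laplacian2_UW_two (y : E3) : Δ (Δ (UW φ 2)) y = 0 := by
  rw [laplacian_UW_two, InnerProductSpace.laplacian_const]; rfl

/-- `ΔW` componentwise (function level). [folklore] -/
theorem laplacian_packet (hφ : ∀ a, ContDiff ℝ ∞ (φ a)) :
    Δ (packet φ) = vec3 (fun i => Δ (UW φ i)) := by
  funext y
  ext i
  rw [packet, laplacian_vec3_apply (fun j => (contDiff_UW hφ j).of_le two_le_infty''), vec3_apply]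

/-- The components `Δ Wᵢ` are smooth. [folklore] -/
theorem contDiff_laplacian_UW (hφ : ∀ a, ContDiff ℝ ∞ (φ a)) (i : Fin 3) :
    ContDiff ℝ ∞ (Δ (UW φ i)) := by
  obtain rfl | rfl | rfl : i = 0 ∨ i = 1 ∨ i = 2 := by fin_cases i <;> simp
  · rw [laplacian_UW_zero hφ]
    exact ((contDiff_sep hφ _ _ _).add (contDiff_sep hφ _ _ _)).add (contDiff_sep hφ _ _ _)
  · rw [laplacian_UW_one hφ]
    exact (((contDiff_sep hφ _ _ _).add (contDiff_sep hφ _ _ _)).add (contDiff_sep hφ _ _ _)).neg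
  · rw [laplacian_UW_two]; exact contDiff_const

/-- `Δ²W` componentwise. [folklore] -/
theorem laplacian2_packet_apply (hφ : ∀ a, ContDiff ℝ ∞ (φ a)) (y : E3) (i : Fin 3) :
    Δ (Δ (packet φ)) y i = Δ (Δ (UW φ i)) y := by
  rw [laplacian_packet hφ,
    laplacian_vec3_apply (fun j => (contDiff_laplacian_UW hφ j).of_le two_le_infty'')]

/-- `ΔW` componentwise (pointwise). [folklore] -/
theorem laplacian_packet_apply (hφ : ∀ a, ContDiff ℝ ∞ (φ a)) (y : E3) (i : Fin 3) :
    Δ (packet φ) y i = Δ (UW φ i) y := by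
  rw [laplacian_packet hφ, vec3_apply]

/-- The packet vanishes outside the ball of radius `4` (profiles vanishing off `[-2,2]`).
[folklore] -/
theorem packet_eq_zero (h0 : ∀ a t, 2 < |t| → φ a t = 0) (y : E3) (hy : 4 ≤ ‖y‖) :
    packet φ y = 0 := by
  refine vec3_eq_zero_of_norm (fun i v a ha => ?_) y hy
  obtain rfl | rfl | rfl : i = 0 ∨ i = 1 ∨ i = 2 := by fin_cases i <;> simp
  · simp [sep_eq_zero h0 _ _ _ ha]
  · simp [sep_eq_zero h0 _ _ _ ha]
  · simp

/-- The packet is divergence free. [folklore] -/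
theorem packet_trace (hφ : ∀ a, ContDiff ℝ ∞ (φ a)) (y : E3) :
    LinearMap.trace ℝ E3 (fderiv ℝ (packet φ) y : E3 →ₗ[ℝ] E3) = 0 := by
  rw [packet, trace_fderiv_vec3 (differentiable_UW hφ), fderiv_UW_zero hφ, fderiv_UW_one hφ,
    fderiv_UW_two]
  simp only [PiLp.single_apply]
  simp

end Packet

end Sep3

end Summit.NavierStokesRegularity.FunctionalMining
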